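import Summits.CriticalPhenomena.PercolationContinuityZ3.Theorems.Transplant.SkelFrmBChoiceReadNums
import HarnessLib

/-!
# N2 (frames-only node `SamePDropOfSkeletonFrm₁`, OPEN), (C)/(R) corridor slots: **THE K-G CORRIDOR VALUES ARE MONOTONE IN THE RUN LENGTH**
# (first axis, integers only) — `Skelφ.kgT₁_mono / KGRows.kgM₁_mono / kgA₁_mono / KGRows.kgX₂_mono / KGRows.kgT₂_mono / KGRows.kgM₂_mono /
# KGRows.kgX_mono / KGRows.kgFar_mono / KGRows.kgZ₀_mono`, and the across half-extent bound `KGRows.kgZ₁_le_of_le` (the N-dependent part of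
# `KGRows.kgZ₁_le`'s right-hand side taken at any larger run length).
Why ((R) column, lane INBOX 2026-08-23T11:32:57Z p3-g17): the ROOT's corridor starts `X1 = core1Lo 0 + q` east of the terminal cell, so it runs at
its own length `N_R := kgN … (kgTgt0 − X1) ≤ kgNv0` (and the second axis' x-prefix at some `Nx ≤ kgNv0`); every slot bound stmt's value files prove AT
`kgNv0` (`m₁Q_le`, `X₂Q_le`, `m₂Q_le`, `Z₀Q_le`, `Z₁Q_le`, and their `small2` successors) transfers to the shorter run by the lemmas here.  Cell-free and
window-generic (no ledger names): survives the (R-44)/(R-45) window/cell successors unchanged.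
builds on p205010 (kernel theorem, internal audit signed; external expert review pending) — nothing in this file uses p205010; nothing here is a
claim about the open node `SamePDropOfSkeletonFrm₁`.
Lane `prim-bschramm`, seat `prim-bschramm-p3` (gen 17; (R) lineage); helper file (`--supports stmt-CriticalPhenomena-4575 --as helper`).
[cite: KozmaNitzan2024, §4 Lemma 12 (pp. 23–25: the target box of a corridor)] [cite: MartineauTassion2017, §4.3 Lemma 4.2 (steering)]
-/

namespace Summit.CriticalPhenomena.PercolationContinuityZ3.Theorems.Transplant

namespace Skelφ

open Literature.Probability.Percolation Literature.Probability.LatticeModels SimpleGraph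
open ChainPlanar ChainPara

section KGMono

variable {n ℓ : ℕ} {hs v : ℤ} {R' ρ q W : ℕ}

/-- `T₁ = 2W + 2(N+1)R′` is monotone in the run length `N`. [this work] -/
theorem kgT₁_mono (R' W : ℕ) {N N' : ℕ} (h : N ≤ N') : kgT₁ R' W N ≤ kgT₁ R' W N' := by
  unfold kgT₁
  have hN : (N : ℤ) ≤ N' := by exact_mod_cast h
  have hR : (0 : ℤ) ≤ R' := by positivity
  nlinarith

/-- `A₁ = P + W + (N+1)R′` is monotone in `N`. [this work] -/
theorem kgA₁_mono (n ℓ : ℕ) (hs : ℤ) (R' W : ℕ) {N N' : ℕ} (h : N ≤ N') : kgA₁ n ℓ hs R' W N ≤ kgA₁ n ℓ hs R' W N' := by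
  unfold kgA₁
  have : (N + 1) * R' ≤ (N' + 1) * R' := Nat.mul_le_mul_right _ (by omega)
  omega

/-- **`m₁` is monotone in `N`** (`m₁ + 1 = ⌊T₁/dec₁⌋`, `dec₁ > 0`). [this work] -/
theorem KGRows.kgM₁_mono (H : KGRows n ℓ hs v R' ρ q W) {N N' : ℕ} (h : N ≤ N') :
    kgM₁ n ℓ hs R' ρ W N ≤ kgM₁ n ℓ hs R' ρ W N' := by
  have hd : 0 < kgDec₁ n ℓ hs R' ρ := by
    have := H.dec₁_pos; have : (0 : ℤ) ≤ R' := by positivity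
    linarith
  unfold kgM₁
  have hdiv : kgT₁ R' W N / kgDec₁ n ℓ hs R' ρ ≤ kgT₁ R' W N' / kgDec₁ n ℓ hs R' ρ :=
    Int.ediv_le_ediv hd (kgT₁_mono R' W h)
  exact Nat.sub_le_sub_right (Int.toNat_le_toNat hdiv) 1

/-- **`X₂ = q + (N+1)R′ + (m₁+1)(R′+ρ+|v|)` is monotone in `N`.** [this work] -/
theorem KGRows.kgX₂_mono (H : KGRows n ℓ hs v R' ρ q W) {N N' : ℕ} (h : N ≤ N') :
    kgX₂ n ℓ hs v R' ρ q W N ≤ kgX₂ n ℓ hs v R' ρ q W N' := by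
  have hm : ((kgM₁ n ℓ hs R' ρ W N : ℕ) : ℤ) ≤ (kgM₁ n ℓ hs R' ρ W N' : ℕ) := by exact_mod_cast H.kgM₁_mono h
  unfold kgX₂
  have hN : (N : ℤ) ≤ N' := by exact_mod_cast h
  have hR : (0 : ℤ) ≤ R' := by positivity
  have hρ : (0 : ℤ) ≤ ρ := by positivity
  have hv : (0 : ℤ) ≤ |v| := abs_nonneg _
  nlinarith

/-- `T₂ = 2X₂ − (n + ρ − 1)` is monotone in `N`. [this work] -/
theorem KGRows.kgT₂_mono (H : KGRows n ℓ hs v R' ρ q W) {N N' : ℕ} (h : N ≤ N') :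
    kgT₂ n ℓ hs v R' ρ q W N ≤ kgT₂ n ℓ hs v R' ρ q W N' := by
  have := H.kgX₂_mono h
  unfold kgT₂; linarith

/-- **`m₂` is monotone in `N`** (`m₂ + 1 = max 1 ⌈T₂/dec₂⌉`, `dec₂ > 0`). [this work] -/
theorem KGRows.kgM₂_mono (H : KGRows n ℓ hs v R' ρ q W) {N N' : ℕ} (h : N ≤ N') :
    kgM₂ n ℓ hs v R' ρ q W N ≤ kgM₂ n ℓ hs v R' ρ q W N' := by
  have hd : 0 < kgDec₂ n R' ρ := by
    have := H.dec₂_pos.1; have : (0 : ℤ) ≤ R' := by positivity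
    have : (0 : ℤ) ≤ ρ := by positivity
    linarith
  unfold kgM₂
  have hdiv : (kgT₂ n ℓ hs v R' ρ q W N + kgDec₂ n R' ρ - 1) / kgDec₂ n R' ρ ≤
      (kgT₂ n ℓ hs v R' ρ q W N' + kgDec₂ n R' ρ - 1) / kgDec₂ n R' ρ :=
    Int.ediv_le_ediv hd (by have := H.kgT₂_mono h; linarith)
  exact Nat.sub_le_sub_right (Int.toNat_le_toNat (max_le_max le_rfl hdiv)) 1

/-- **The arrival overshoot `X = X₂ + (m₂+1)(R′+ρ)` is monotone in `N`.** [this work] -/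
theorem KGRows.kgX_mono (H : KGRows n ℓ hs v R' ρ q W) {N N' : ℕ} (h : N ≤ N') :
    kgX n ℓ hs v R' ρ q W N ≤ kgX n ℓ hs v R' ρ q W N' := by
  have hX := H.kgX₂_mono h
  have hm : ((kgM₂ n ℓ hs v R' ρ q W N : ℕ) : ℤ) ≤ (kgM₂ n ℓ hs v R' ρ q W N' : ℕ) := by exact_mod_cast H.kgM₂_mono h
  unfold kgX
  have hR : (0 : ℤ) ≤ R' := by positivity
  have hρ : (0 : ℤ) ≤ ρ := by positivity
  nlinarith

/-- **The arrival's far edge `(N+1)n + X` is monotone in `N`.** [this work] -/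
theorem KGRows.kgFar_mono (H : KGRows n ℓ hs v R' ρ q W) {N N' : ℕ} (h : N ≤ N') :
    kgFar n ℓ hs v R' ρ q W N ≤ kgFar n ℓ hs v R' ρ q W N' := by
  have hX := H.kgX_mono h
  unfold kgFar
  have hN : (N : ℤ) ≤ N' := by exact_mod_cast h
  have hn : (0 : ℤ) ≤ n := by positivity
  nlinarith

/-- **The along half-extent `Z₀` of the prism box (at the schedule's own `m₁, m₂`) is monotone in `N`.** [this work] -/
theorem KGRows.kgZ₀_mono (H : KGRows n ℓ hs v R' ρ q W) {N N' : ℕ} (h : N ≤ N') :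
    kgZ₀ n v R' ρ q N (kgM₁ n ℓ hs R' ρ W N) (kgM₂ n ℓ hs v R' ρ q W N) ≤
      kgZ₀ n v R' ρ q N' (kgM₁ n ℓ hs R' ρ W N') (kgM₂ n ℓ hs v R' ρ q W N') := by
  rw [kgZ₀_eq, kgZ₀_eq]
  have := H.kgX_mono h
  linarith

/-- **The across half-extent `Z₁` at run length `N` is bounded by `KGRows.kgZ₁_le`'s right-hand side at any `N′ ≥ N`:**
`Z₁(N) ≤ 7P + W + sL + (N′+1)R′ + (m₁(N′) + m₂(N′) + 2)(R′+ρ)`. [this work] -/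
theorem KGRows.kgZ₁_le_of_le (H : KGRows n ℓ hs v R' ρ q W) {N N' : ℕ} (h : N ≤ N') :
    kgZ₁ n ℓ hs R' ρ W N (kgM₁ n ℓ hs R' ρ W N) (kgWm₂ n ℓ hs R' ρ W N) (kgWp₂ n ℓ hs R' ρ W N) (kgM₂ n ℓ hs v R' ρ q W N) ≤
      7 * ((n * ℓ / shearUnit n hs + 1 : ℕ) : ℤ) + W + kgSL n ℓ hs + ((N' : ℤ) + 1) * R' +
        ((((kgM₁ n ℓ hs R' ρ W N' : ℕ) : ℤ)) + (kgM₂ n ℓ hs v R' ρ q W N' : ℕ) + 2) * ((R' : ℤ) + ρ) := by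
  have hZ := H.kgZ₁_le N
  have hm₁ : ((kgM₁ n ℓ hs R' ρ W N : ℕ) : ℤ) ≤ (kgM₁ n ℓ hs R' ρ W N' : ℕ) := by exact_mod_cast H.kgM₁_mono h
  have hm₂ : ((kgM₂ n ℓ hs v R' ρ q W N : ℕ) : ℤ) ≤ (kgM₂ n ℓ hs v R' ρ q W N' : ℕ) := by exact_mod_cast H.kgM₂_mono h
  have hN : (N : ℤ) ≤ N' := by exact_mod_cast h
  have hR : (0 : ℤ) ≤ R' := by positivity
  have hρ : (0 : ℤ) ≤ ρ := by positivity
  nlinarith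

/-- **The schedule length `N + 1 + (m₁+1) + (m₂+1)` is monotone in `N`** (so a shorter run fits the same length budget). [this work] -/
theorem KGRows.kgSchedLen_mono (H : KGRows n ℓ hs v R' ρ q W) {N N' : ℕ} (h : N ≤ N') :
    N + 1 + (kgM₁ n ℓ hs R' ρ W N + 1) + (kgM₂ n ℓ hs v R' ρ q W N + 1) ≤
      N' + 1 + (kgM₁ n ℓ hs R' ρ W N' + 1) + (kgM₂ n ℓ hs v R' ρ q W N' + 1) := by
  have := H.kgM₁_mono h
  have := H.kgM₂_mono h
  omega

end KGMono

end Skelφ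

end Summit.CriticalPhenomena.PercolationContinuityZ3.Theorems.Transplant
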